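import Literature.NumberTheory.EllipticCurves.BhargavaShankarCongruenceOrbitBoundProofs
import Literature.NumberTheory.EllipticCurves.BinaryQuarticIrreducibleInvariance
import HarnessLib

/-!
# The upper half of Thm 2.12 (congruence conditions) for a fundamental set of pieces:
# the `∀ ε, eventually` form (Bhargava–Shankar §2.3, §2.5)

`Proofs` file (theorems only: no definitions, no named facts). Topic
`Literature/NumberTheory/EllipticCurves`; continues `BhargavaShankarCongruenceOrbitBoundProofs.lean`
(`ncard_orbits_le`: `#(Γ\𝒮) ≤ 32500 X^{2/3} + (2/(nᵣ μ(G₀)))(A π²/3 + B √Λ π)`).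

For a family of pieces `D` (cones over `C¹` curves, `BhargavaShankarLatticeCount.Piece`) which is a
fundamental set for a `GL₂(ℤ)`-invariant set `V ⊆ V_ℤ` of forms — every irreducible `x ∈ V` of
height `< X` is `SL₂^±(ℝ)`-equivalent to a section of `𝓛_X = sections D X`, the sections form a
section set, and their real stabilisers have `≥ nᵣ` elements — and for every set
`S ⊆ (ℤ/qℤ)⁵` of residues with `GL₂(ℤ)`-invariant pull-back `S̃`, we prove
(`eventually_classCount_le_of_pieces`): for every `ε > 0`, eventually in `X`,

`N(V ∩ S̃; X) ≤ (#S/q⁵ · (2 vol(B₁)/(nᵣ μ(G₀))) · π²/3 + ε) · X^{5/6}`,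

i.e. the upper half of Bhargava–Shankar's Thm 2.11 (`arXiv:1006.1002v2`; Thm 2.12 of the
published paper: "`N(S ∩ V^{(i)}; X) = N(V^{(i)}; X) ∏_p μ_p(S) + O(X^{3/4+ε})`") with the main
constant of Thm 2.1 written as `2 vol(B₁)/(nᵣ μ(G₀)) · μ(𝓕)`, `μ(𝓕) = π²/3 = 2ζ(2)`. The error
terms `32500 X^{2/3}` (big stabilisers) and `B √Λ π ≍ X^{3/4}` (the cusp-truncated Lipschitz
error) are absorbed into `ε X^{5/6}`. Also: the `Γ`-invariance of the counted set
(`smul_mem_countedSet`). The instantiation for the three types `i = 0, 2+, 1` (pieces, coverage,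
`nᵣ = 8, 8, 4`, `vol(B₁) = (8, 8, 32) μ(G₀)/135`) is the companion file.

## References

* M. Bhargava, A. Shankar, Ann. of Math. (2) 181 (2015) 191–242, Thm 2.1, §2.3 and §2.5
  Thm 2.11 (arXiv:1006.1002v2 numbering; Thm 2.12 published). [cite: BhargavaShankarAnnals2015, §2.5 Thm 2.11 (arXiv:1006.1002v2 numbering; = Thm 2.12 published)]
-/

noncomputable section

open Real MeasureTheory Matrix Set Filter Topology
open scoped MatrixGroups ENNReal

namespace Literature.NumberTheory.EllipticCurves

namespace BinaryQuartic

open Literature.MeasureTheory.Group Literature.Algebra.EuclideanLattices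

variable {K : ℕ} (D : Fin K → Piece)

/-! ## `Γ`-invariance of the counted set -/

/-- `γ • f` is `GL₂(ℤ)`-equivalent to `f`. [folklore] -/
theorem gl2zEquiv_smul (γ : gl2zGL) (f : BinaryQuartic ℤ) : GL2ZEquiv f (γ • f) := by
  refine ⟨((intGL γ : GL (Fin 2) ℤ) : Matrix (Fin 2) (Fin 2) ℤ), ?_, gl2z_smul_def γ f⟩
  rw [← Matrix.GeneralLinearGroup.val_det_apply]; exact Units.isUnit _

/-- **The counted set `{f ∈ V ∩ S̃ : f irreducible, H(f) < X}` is `Γ`-invariant** when `V` and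
`S̃` are. [cite: BhargavaShankarAnnals2015, §2.5 (S is GL₂(ℤ)-invariant; arXiv:1006.1002v2 numbering)] -/
theorem smul_mem_countedSet {Vset : Set (BinaryQuartic ℤ)}
    (hV : ∀ f g : BinaryQuartic ℤ, GL2ZEquiv f g → (g ∈ Vset ↔ f ∈ Vset))
    {q : ℕ} (S : Finset (Fin 5 → ZMod q))
    (hS : ∀ f g : BinaryQuartic ℤ, GL2ZEquiv f g →
      ((fun j => ((g.coeffs j : ℤ) : ZMod q)) ∈ S ↔ (fun j => ((f.coeffs j : ℤ) : ZMod q)) ∈ S))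
    (X : ℝ) (γ : gl2zGL) (x : BinaryQuartic ℤ)
    (hx : x ∈ {f : BinaryQuartic ℤ | f ∈ Vset ∩ {f | (fun j => ((f.coeffs j : ℤ) : ZMod q)) ∈ S} ∧
      f.IsIrreducible ∧ f.height < X}) :
    γ • x ∈ {f : BinaryQuartic ℤ | f ∈ Vset ∩ {f | (fun j => ((f.coeffs j : ℤ) : ZMod q)) ∈ S} ∧
      f.IsIrreducible ∧ f.height < X} := by
  obtain ⟨⟨hxV, hxS⟩, hirr, hH⟩ := hx
  have he := gl2zEquiv_smul γ x
  refine ⟨⟨(hV x _ he).2 hxV, (hS x _ he).2 hxS⟩, he.isIrreducible_iff.2 hirr, ?_⟩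
  rw [gl2z_smul_def, height_subst_of_isUnit]
  · exact hH
  · rw [← Matrix.GeneralLinearGroup.val_det_apply]; exact Units.isUnit _

/-! ## Absorbing the error terms -/

/-- The error terms are `O(X^{3/4})`: for `X ≥ 1`,
`32500 X^{2/3} + c · Λ⁴ √Λ ≤ (32500 + c Λ₁⁴ √Λ₁) X^{3/4}` with `Λ = Λ₁ X^{1/6}`,
`Λ₁ = 20 C₁ L`. [folklore] -/
theorem errorTerms_le {X : ℝ} (hX : 1 ≤ X) (c : ℝ) :
    32500 * X ^ (2 / 3 : ℝ) + c * (Lam D X ^ 4 * Real.sqrt (Lam D X)) ≤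
      (32500 + c * ((20 * C₁ * Lmax D) ^ 4 * Real.sqrt (20 * C₁ * Lmax D))) * X ^ (3 / 4 : ℝ) := by
  have hX0 : 0 < X := by linarith
  obtain ⟨Λ₁, hΛ₁def⟩ : ∃ L : ℝ, 20 * C₁ * Lmax D = L := ⟨_, rfl⟩
  have hΛ₁ : 0 < Λ₁ := by rw [← hΛ₁def]; have := C₁_pos; have := one_le_Lmax D; positivity
  have hΛ : Lam D X = Λ₁ * X ^ (1 / 6 : ℝ) := by rw [Lam, hΛ₁def]
  rw [hΛ₁def]
  have h23 : X ^ (2 / 3 : ℝ) ≤ X ^ (3 / 4 : ℝ) := Real.rpow_le_rpow_of_exponent_le hX (by norm_num)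
  have hX6 : 0 ≤ X ^ (1 / 6 : ℝ) := Real.rpow_nonneg hX0.le _
  -- `Λ⁴ √Λ = Λ₁⁴ √Λ₁ · X^{3/4}`
  have hpow : Lam D X ^ 4 * Real.sqrt (Lam D X) = Λ₁ ^ 4 * Real.sqrt Λ₁ * X ^ (3 / 4 : ℝ) := by
    rw [hΛ, mul_pow, Real.sqrt_mul hΛ₁.le, Real.sqrt_eq_rpow, Real.sqrt_eq_rpow, ← Real.rpow_natCast,
      ← Real.rpow_natCast (X ^ (1 / 6 : ℝ)), ← Real.rpow_mul hX0.le, ← Real.rpow_mul hX0.le]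
    have e : X ^ (3 / 4 : ℝ) = X ^ ((1 / 6 : ℝ) * (4 : ℕ)) * X ^ ((1 / 6 : ℝ) * (1 / 2)) := by
      rw [← Real.rpow_add hX0]; norm_num
    rw [e]; ring
  rw [hpow]
  have h32500 := mul_le_mul_of_nonneg_left h23 (by norm_num : (0:ℝ) ≤ 32500)
  linarith

/-- `C X^{3/4} ≤ ε X^{5/6}` eventually. [folklore] -/
theorem eventually_mul_rpow_le (C : ℝ) {ε : ℝ} (hε : 0 < ε) :
    ∀ᶠ X : ℝ in atTop, C * X ^ (3 / 4 : ℝ) ≤ ε * X ^ (5 / 6 : ℝ) := by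
  have ht : Tendsto (fun X : ℝ => C * X ^ (-(1 / 12 : ℝ))) atTop (𝓝 (C * 0)) :=
    (tendsto_rpow_neg_atTop (by norm_num : (0 : ℝ) < 1 / 12)).const_mul C
  rw [mul_zero] at ht
  filter_upwards [ht.eventually (gt_mem_nhds hε), eventually_ge_atTop (1 : ℝ)] with X hlt hX
  have hX0 : 0 < X := by linarith
  have e : X ^ (3 / 4 : ℝ) = X ^ (-(1 / 12 : ℝ)) * X ^ (5 / 6 : ℝ) := by
    rw [← Real.rpow_add hX0]; norm_num
  rw [e, ← mul_assoc]
  exact mul_le_mul_of_nonneg_right hlt.le (Real.rpow_nonneg hX0.le _)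

/-! ## The upper half of Thm 2.12 for a fundamental set of pieces -/

section Measure

variable [MeasurableSpace (Matrix (Fin 2) (Fin 2) ℝ)] [BorelSpace (Matrix (Fin 2) (Fin 2) ℝ)]

/-- **Upper half of Bhargava–Shankar's Thm 2.12 (congruence conditions) for a fundamental set of
pieces.** Let `D` be pieces such that for `X ≥ 1` the sections `𝓛_X` form a section set whose
forms have real stabilisers of size `≥ nᵣ ≥ 1`, and such that every irreducible form of a
`GL₂(ℤ)`-invariant set `V` of height `< X` is `SL₂^±(ℝ)`-equivalent to a section; let
`vol(B₁) ≤ v`. Then for every modulus `q`, every set `S` of residues with `GL₂(ℤ)`-invariant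
pull-back `S̃` and every `ε > 0`, eventually
`N(V ∩ S̃; X) ≤ (#S/q⁵ · (2v/(nᵣ μ(G₀)) · π²/3) + ε) X^{5/6}`.
[cite: BhargavaShankarAnnals2015, §2.5 Thm 2.11 (arXiv:1006.1002v2 numbering; = Thm 2.12 published), upper bound] -/
theorem eventually_classCount_le_of_pieces
    (h𝓛 : ∀ X : ℝ, 1 ≤ X → IsSectionSet (sections D X))
    {Vset : Set (BinaryQuartic ℤ)} (hV : ∀ f g : BinaryQuartic ℤ, GL2ZEquiv f g → (g ∈ Vset ↔ f ∈ Vset))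
    (hcov : ∀ X : ℝ, 1 ≤ X → ∀ x ∈ Vset, x.IsIrreducible → x.height < X →
      ∃ ℓ₀ ∈ sections D X, ∃ g₀ : Matrix (Fin 2) (Fin 2) ℝ, (g₀.det = 1 ∨ g₀.det = -1) ∧
        x.map (Int.castRingHom ℝ) = ℓ₀.subst g₀)
    {nR : ℕ} (hnRpos : 0 < nR) (hnR : ∀ X : ℝ, 1 ≤ X → ∀ ℓ ∈ sections D X, nR ≤ (substStabilizer ℓ).ncard)
    {v : ℝ} (hvol : volume.real (B1set D) ≤ v)
    {q : ℕ} [NeZero q] (S : Finset (Fin 5 → ZMod q))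
    (hS : ∀ f g : BinaryQuartic ℤ, GL2ZEquiv f g →
      ((fun j => ((g.coeffs j : ℤ) : ZMod q)) ∈ S ↔ (fun j => ((f.coeffs j : ℤ) : ZMod q)) ∈ S)) :
    ∀ ε : ℝ, 0 < ε → ∀ᶠ X : ℝ in atTop,
      (gl2zClassCount (Vset ∩ {f : BinaryQuartic ℤ | (fun j => ((f.coeffs j : ℤ) : ZMod q)) ∈ S}) X : ℝ) ≤
        ((S.card : ℝ) / (q : ℝ) ^ 5 * (2 * v / (nR * boxHaar) * (π ^ 2 / 3)) + ε) * X ^ (5 / 6 : ℝ) := by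
  intro ε hε
  set cB : ℝ := 2 / (nR * boxHaar) * (S.card * (576000 * K) * π) with hcB
  have hbH := boxHaar_pos
  have hnR' : (0 : ℝ) < nR := by exact_mod_cast hnRpos
  set CE : ℝ := 32500 + cB * ((20 * C₁ * Lmax D) ^ 4 * Real.sqrt (20 * C₁ * Lmax D)) with hCE
  filter_upwards [eventually_mul_rpow_le CE hε, eventually_ge_atTop (1 : ℝ)] with X herr hX
  have hX0 : 0 < X := by linarith
  set 𝒮 := {f : BinaryQuartic ℤ | f ∈ Vset ∩ {f | (fun j => ((f.coeffs j : ℤ) : ZMod q)) ∈ S} ∧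
    f.IsIrreducible ∧ f.height < X} with h𝒮def
  have hcount : gl2zClassCount (Vset ∩ {f : BinaryQuartic ℤ | (fun j => ((f.coeffs j : ℤ) : ZMod q)) ∈ S}) X =
      (gl2zOrbit '' 𝒮).ncard := rfl
  have hmain := ncard_orbits_le D hX (h𝓛 X hX) S
    (𝒮 := 𝒮) (fun γ x hx => smul_mem_countedSet hV S hS X γ x hx)
    (fun f hf => hf.2.1) (fun f hf => hf.2.2) (fun f hf => hf.1.2)
    (fun x hx => hcov X hX x hx.1.1 hx.2.1 hx.2.2) hnRpos (hnR X hX)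
  rw [hcount]
  refine hmain.trans ?_
  have hS0 : (0 : ℝ) ≤ S.card := Nat.cast_nonneg _
  have hX56 : 0 ≤ X ^ (5 / 6 : ℝ) := Real.rpow_nonneg hX0.le _
  have hq0 : 0 < (q : ℝ) ^ 5 := pow_pos (by exact_mod_cast Nat.pos_of_ne_zero (NeZero.ne q)) _
  -- main term: `vol(B₁) ≤ v`
  have hmainterm : 2 / (nR * boxHaar) * (S.card * (X ^ (5 / 6 : ℝ) * volume.real (B1set D) / (q : ℝ) ^ 5) * (π ^ 2 / 3)) ≤
      (S.card : ℝ) / (q : ℝ) ^ 5 * (2 * v / (nR * boxHaar) * (π ^ 2 / 3)) * X ^ (5 / 6 : ℝ) := by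
    have h1 : X ^ (5 / 6 : ℝ) * volume.real (B1set D) ≤ X ^ (5 / 6 : ℝ) * v := mul_le_mul_of_nonneg_left hvol hX56
    have h2 : 0 ≤ 2 / (nR * boxHaar) := by positivity
    calc 2 / (nR * boxHaar) * (S.card * (X ^ (5 / 6 : ℝ) * volume.real (B1set D) / (q : ℝ) ^ 5) * (π ^ 2 / 3))
        ≤ 2 / (nR * boxHaar) * (S.card * (X ^ (5 / 6 : ℝ) * v / (q : ℝ) ^ 5) * (π ^ 2 / 3)) := by
          gcongr
      _ = (S.card : ℝ) / (q : ℝ) ^ 5 * (2 * v / (nR * boxHaar) * (π ^ 2 / 3)) * X ^ (5 / 6 : ℝ) := by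
          field_simp
  -- error terms
  have herr' : 32500 * X ^ (2 / 3 : ℝ) +
      2 / (nR * boxHaar) * (S.card * (576000 * K * Lam D X ^ 4) * (Real.sqrt (Lam D X) * π)) ≤ ε * X ^ (5 / 6 : ℝ) := by
    have e : 2 / (nR * boxHaar) * (S.card * (576000 * K * Lam D X ^ 4) * (Real.sqrt (Lam D X) * π)) =
        cB * (Lam D X ^ 4 * Real.sqrt (Lam D X)) := by rw [hcB]; ring
    rw [e]
    exact (errorTerms_le D hX cB).trans herr
  calc 32500 * X ^ (2 / 3 : ℝ) + 2 / (nR * boxHaar) *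
        (S.card * (X ^ (5 / 6 : ℝ) * volume.real (B1set D) / (q : ℝ) ^ 5) * (π ^ 2 / 3) +
          S.card * (576000 * K * Lam D X ^ 4) * (Real.sqrt (Lam D X) * π))
      = 2 / (nR * boxHaar) * (S.card * (X ^ (5 / 6 : ℝ) * volume.real (B1set D) / (q : ℝ) ^ 5) * (π ^ 2 / 3)) +
          (32500 * X ^ (2 / 3 : ℝ) +
            2 / (nR * boxHaar) * (S.card * (576000 * K * Lam D X ^ 4) * (Real.sqrt (Lam D X) * π))) := by ring
    _ ≤ (S.card : ℝ) / (q : ℝ) ^ 5 * (2 * v / (nR * boxHaar) * (π ^ 2 / 3)) * X ^ (5 / 6 : ℝ) + ε * X ^ (5 / 6 : ℝ) :=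
        add_le_add hmainterm herr'
    _ = ((S.card : ℝ) / (q : ℝ) ^ 5 * (2 * v / (nR * boxHaar) * (π ^ 2 / 3)) + ε) * X ^ (5 / 6 : ℝ) := by ring

end Measure

end BinaryQuartic

end Literature.NumberTheory.EllipticCurves

end
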